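import Summits.ResolutionOfSingularities.ResolutionOfSingularities.Theses.DefectlessFrames

/-!
# `PureTranscendentalFrames` — negative lemmas I: load-bearing frame hypotheses, purity dichotomy

Support (negative) lemmas for crux `stmt-ResolutionOfSingularities-18874`
(`…Theses.DefectlessFrames.PureTranscendentalFrames`: along a rank-one zero-dimensional valuation
ring `O ⊇ k` of a finitely generated `K/k`, `k` perfect of characteristic `p`, every frame
`x : Fin (n+1) → O` of algebraically independent elements carrying a nonzero polynomial `g` is
dominated (`k[x] ⊆ k[x']`) by a frame `x'` with transported `G` (`G(x') = g(x)`) in general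
position (`G(x̄'_{<n}, X) ≠ 0`), axis order not increased, whose last element `w` is PURE over
`K₁ = k(x'_{<n})`: the distance `min_a v(w − a)` is attained in `K₁`, OR for every nonzero
`q ∈ K₁[X]` some `a ∈ K₁` has `v(q(w) − q(a)) < v(q(w))`), filed by the standing disprover
(cdisprove cycle 1; work file `Cruxes/PureTranscendentalFrames/Disproof.lean`, which carries the
full analysis of why the crux resists). This file declares NO definition: every variant statement
is the crux written out verbatim with ONE token edited, and NO declaration concludes the route decl
positively.

* `pureTranscendentalFrames_false_without_g_ne_zero` — with the frame hypothesis `g ≠ 0` dropped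
  the statement is FALSE: `k = 𝔽₂`, `K = k(X)`, `O` the `X`-adic place, `n = 0`, `x = (X)`,
  `g = 0`; the transported polynomial has `G(x') = 0`, so `G = 0` (algebraic independence of `x'`)
  and `axis 0 x' G = 0`, contradicting general position. Any proof must use `g ≠ 0`.
* `pureTranscendentalFrames_false_without_algIndep` — with `AlgebraicIndependent k x` dropped it
  is FALSE: same place, `x = (0)`, `g = X₀`: again `G(x') = g(0) = 0`.
* `not_pureTranscendentalFrames_transcendentalTypeOnly` — the natural STRENGTHENING that deletes
  the attained-distance disjunct (purity := "transcendental approximation type" only) is FALSE: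
  same place, `n = 0`, `x = (X)`, `g = 1`; for EVERY frame `x' = (w)`, `K₁ = k` and
  `w ≡ c (mod 𝔪_O)` with `c ∈ k` (the place is residually rational), and `q = X − c` has
  `v(q(w) − q(a)) = v(w − a) ≥ v(w − c) = v(q(w))` for all `a ∈ k`. So the attained-distance
  branch is load-bearing already over `K₁ = k`; dually (COMMENT in the work file) the crux is
  TRUE at `n = 0` over any field via that branch, and at `n = 1` the whole purity clause is
  automatic because `k(x'₀)` is discretely valued — the open content is `n ≥ 2`.

The model lemmas (`X`-adic place of `k(X)` for an arbitrary field `k`: rank one, residually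
rational, `k(X)/k` finitely generated) are proved here in full and are reusable.

## Sources
* O. Zariski, *Local uniformization on algebraic varieties*, Ann. of Math. 41 (1940) 852–896,
  C.I–C.III (the Lemma case of the translation loop = purity of the last frame element).
* S. D. Cutkosky, H. Mourtada, *Defect and local uniformization*, arXiv:1711.02726 (2019), §6–7.
* I. Kaplansky, *Maximal fields with valuations*, Duke Math. J. 9 (1942) 303–321 (pseudo-Cauchy
  sequences of transcendental / algebraic type).
-/

noncomputable section

set_option linter.dupNamespace false -- mandated namespace of this single-conjunct summit

open scoped Polynomial
open IsDedekindDomain.HeightOneSpectrum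

namespace Summit.ResolutionOfSingularities.ResolutionOfSingularities.Theorems.PureTranscendentalFrames.Negative

/-! ## §1 The model: the `X`-adic place of `k(X)` (any field `k`) -/

section Model

variable (k : Type) [Field k]

/-- `X ∈ O`. [folklore] -/
theorem X_mem_OX :
    (RatFunc.X : RatFunc k) ∈ ((Polynomial.idealX k).valuation (RatFunc k)).valuationSubring := by
  rw [Valuation.mem_valuationSubring_iff, Polynomial.valuation_X_eq_neg_one, ← WithZero.exp_zero,
    WithZero.exp_le_exp]
  decide

/-- constants lie in `O`. [folklore] -/
theorem const_mem_OX (c : k) :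
    algebraMap k (RatFunc k) c ∈ ((Polynomial.idealX k).valuation (RatFunc k)).valuationSubring := by
  rw [Valuation.mem_valuationSubring_iff, IsScalarTower.algebraMap_apply k k[X] (RatFunc k)]
  exact valuation_le_one _ _

/-- nonzero constants are units of `O`: valuation `1`. [folklore] -/
theorem v_const_eq_one {c : k} (hc : c ≠ 0) :
    (Polynomial.idealX k).valuation (RatFunc k) (algebraMap k (RatFunc k) c) = 1 := by
  rw [IsScalarTower.algebraMap_apply k k[X] (RatFunc k), valuation_of_algebraMap,
    intValuation_eq_one_iff, Polynomial.idealX_span, Ideal.mem_span_singleton,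
    Polynomial.algebraMap_eq, Polynomial.X_dvd_iff, Polynomial.coeff_C_zero]
  exact hc

/-- the valuation of `O` is equivalent to the `X`-adic valuation. [folklore] -/
theorem isEquiv_OX :
    ((Polynomial.idealX k).valuation (RatFunc k)).IsEquiv
      ((Polynomial.idealX k).valuation (RatFunc k)).valuationSubring.valuation :=
  Valuation.isEquiv_valuation_valuationSubring _

/-- `O` is rank one. [folklore] -/
theorem rankOne_OX :
    Nonempty ((Polynomial.idealX k).valuation (RatFunc k)).valuationSubring.valuation.RankOne := by
  haveI : ((Polynomial.idealX k).valuation (RatFunc k)).valuationSubring.valuation.IsNontrivial := by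
    refine ⟨RatFunc.X, ?_, ?_⟩
    · simp [RatFunc.X_ne_zero]
    · intro h1
      have := ((isEquiv_OX k).symm.eq_one_iff_eq_one).mp h1
      simp [Polynomial.valuation_X_eq_neg_one] at this
  rw [Valuation.nonempty_rankOne_iff_mulArchimedean]
  haveI h1 : MulArchimedean
      (MonoidWithZeroHom.ValueGroup₀ (.ofClass ((Polynomial.idealX k).valuation (RatFunc k)))) :=
    MulArchimedean.comap MonoidWithZeroHom.ValueGroup₀.embedding.toMonoidHom
      MonoidWithZeroHom.ValueGroup₀.embedding_strictMono
  exact MulArchimedean.comap ((isEquiv_OX k).symm.orderMonoidIso).toMonoidHom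
    ((isEquiv_OX k).symm.orderMonoidIso).strictMono

/-- residually rational: every `x ∈ O` is congruent to a constant modulo `𝔪_O`. [folklore] -/
theorem exists_const_OX (x : RatFunc k)
    (hx : x ∈ ((Polynomial.idealX k).valuation (RatFunc k)).valuationSubring) :
    ∃ c : k, (Polynomial.idealX k).valuation (RatFunc k) (x - algebraMap k (RatFunc k) c) < 1 := by
  rw [Valuation.mem_valuationSubring_iff] at hx
  have hd : x.denom ≠ 0 := RatFunc.denom_ne_zero x
  have hd' : algebraMap k[X] (RatFunc k) x.denom ≠ 0 := RatFunc.algebraMap_ne_zero hd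
  -- the denominator is not divisible by `X`
  have hd0 : x.denom.coeff 0 ≠ 0 := by
    intro h0
    have hXd : Polynomial.X ∣ x.denom := Polynomial.X_dvd_iff.mpr h0
    have hvd : (Polynomial.idealX k).intValuation x.denom < 1 :=
      (intValuation_lt_one_iff_mem _ _).mpr
        (by rw [Polynomial.idealX_span]; exact Ideal.mem_span_singleton.mpr hXd)
    have hXn : ¬ Polynomial.X ∣ x.num := by
      intro hXn
      obtain ⟨a, b, hab⟩ := RatFunc.isCoprime_num_denom x
      have : Polynomial.X ∣ (1 : k[X]) := hab ▸ dvd_add (dvd_mul_of_dvd_right hXn a)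
        (dvd_mul_of_dvd_right hXd b)
      exact Polynomial.not_isUnit_X (isUnit_of_dvd_one this)
    have hvn : (Polynomial.idealX k).intValuation x.num = 1 :=
      intValuation_eq_one_iff.mpr
        (by rw [Polynomial.idealX_span]; exact fun h => hXn (Ideal.mem_span_singleton.mp h))
    have hvx : (Polynomial.idealX k).valuation (RatFunc k) x =
        1 / (Polynomial.idealX k).intValuation x.denom := by
      conv_lhs => rw [← RatFunc.num_div_denom x]
      rw [map_div₀, valuation_of_algebraMap, valuation_of_algebraMap, hvn]
    have hpos : 0 < (Polynomial.idealX k).intValuation x.denom :=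
      zero_lt_iff.mpr (intValuation_ne_zero _ _ hd)
    have : 1 < (Polynomial.idealX k).valuation (RatFunc k) x := by
      rw [hvx, one_div, one_lt_inv₀ hpos]; exact hvd
    exact absurd hx (not_le.mpr this)
  have hvd : (Polynomial.idealX k).intValuation x.denom = 1 :=
    intValuation_eq_one_iff.mpr (by
      rw [Polynomial.idealX_span]
      exact fun h => hd0 (Polynomial.X_dvd_iff.mp (Ideal.mem_span_singleton.mp h)))
  set c : k := x.num.coeff 0 / x.denom.coeff 0 with hc
  refine ⟨c, ?_⟩
  have hx' : x - algebraMap k (RatFunc k) c =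
      algebraMap k[X] (RatFunc k) (x.num - Polynomial.C c * x.denom) /
        algebraMap k[X] (RatFunc k) x.denom := by
    rw [map_sub, map_mul, sub_div, mul_div_assoc, div_self hd', mul_one,
      IsScalarTower.algebraMap_apply k k[X] (RatFunc k) c, Polynomial.algebraMap_eq,
      RatFunc.num_div_denom]
  rw [hx', map_div₀, valuation_of_algebraMap, valuation_of_algebraMap, hvd, div_one,
    intValuation_lt_one_iff_mem, Polynomial.idealX_span, Ideal.mem_span_singleton,
    Polynomial.X_dvd_iff]
  simp [hc, div_mul_cancel₀ _ hd0]

/-- zero-dimensional: the residue field of `O` is algebraic over `k` (crux typing). [folklore] -/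
theorem zeroDim_OX : ∀ x ∈ ((Polynomial.idealX k).valuation (RatFunc k)).valuationSubring,
    ∃ f : Polynomial k, f ≠ 0 ∧
      Polynomial.aeval x f ∈ ((Polynomial.idealX k).valuation (RatFunc k)).valuationSubring.nonunits := by
  intro x hx
  obtain ⟨c, hc⟩ := exists_const_OX k x hx
  refine ⟨Polynomial.X - Polynomial.C c, Polynomial.X_sub_C_ne_zero c, ?_⟩
  rw [ValuationSubring.mem_nonunits_iff, ← (isEquiv_OX k).lt_one_iff_lt_one]
  simpa only [map_sub, Polynomial.aeval_X, Polynomial.aeval_C] using hc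

/-- `k(X)/k` is finitely generated. [folklore] -/
theorem fg_top : (⊤ : IntermediateField k (RatFunc k)).FG :=
  ⟨{RatFunc.X}, by simp [RatFunc.adjoin_X]⟩

/-- the one-element frame `(X)` is algebraically independent. [folklore] -/
theorem algInd_X : AlgebraicIndependent k (fun _ : Fin (0 + 1) => (RatFunc.X : RatFunc k)) := by
  haveI : Subsingleton (Fin (0 + 1)) := inferInstanceAs (Subsingleton (Fin 1))
  rw [algebraicIndependent_singleton_iff (0 : Fin (0 + 1))]
  exact RatFunc.transcendental_X

end Model

/-! ## §2 Load-bearing frame hypotheses; the purity dichotomy -/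

section Refutations


/-- **`g ≠ 0` is load-bearing.** With `g ≠ 0` dropped the crux is FALSE: `k = 𝔽₂`, `K = k(X)`,
`O` the `X`-adic place, `n = 0`, `x = (X)`, `g = 0`; the transported `G` has `G(x') = 0`, so
`G = 0` by algebraic independence of `x'`, and then `axis 0 x' G = 0`, contradicting general
position. [folklore] -/
theorem pureTranscendentalFrames_false_without_g_ne_zero :
    ¬ (
      ∀ p : ℕ, p.Prime → ∀ (k K : Type) [Field k] [CharP k p] [PerfectField k] [Field K] [Algebra k
      K], (⊤ : IntermediateField k K).FG → ∀ O : ValuationSubring K, ∀ hk : (∀ c : k, algebraMap k K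
      c ∈ O), Nonempty O.valuation.RankOne → (∀ x ∈ O, ∃ f : Polynomial k, f ≠ 0 ∧ Polynomial.aeval
      x f ∈ O.nonunits) →
      let ρ : k →+* IsLocalRing.ResidueField O := (IsLocalRing.residue O).comp ((algebraMap k
          K).codRestrict O hk);
      let axis : (m : ℕ) → (Fin (m + 1) → O) → MvPolynomial (Fin (m + 1)) k → Polynomial
          (IsLocalRing.ResidueField O) := fun _ w g => MvPolynomial.eval₂ (Polynomial.C.comp ρ)
          (Fin.snoc (fun j => Polynomial.C (IsLocalRing.residue O (w (Fin.castSucc j))))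
          Polynomial.X) g;
      ∀ (n : ℕ) (x : Fin (n + 1) → O) (g : MvPolynomial (Fin (n + 1)) k), AlgebraicIndependent k
      (fun i => (x i : K)) → ∃ (x' : Fin (n + 1) → O) (G : MvPolynomial (Fin (n + 1)) k),
      AlgebraicIndependent k (fun i => (x' i : K)) ∧ (∀ i, (x i : K) ∈ Algebra.adjoin k (Set.range
      fun i => (x' i : K))) ∧ MvPolynomial.aeval (fun i => (x' i : K)) G = MvPolynomial.aeval (fun i
      => (x i : K)) g ∧ axis n x' G ≠ 0 ∧ (axis n x g ≠ 0 → (axis n x' G).rootMultiplicity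
      (IsLocalRing.residue O (x' (Fin.last n))) ≤ (axis n x g).rootMultiplicity (IsLocalRing.residue
      O (x (Fin.last n)))) ∧
      let K₁ : IntermediateField k K := IntermediateField.adjoin k (Set.range fun j : Fin n => (x'
          (Fin.castSucc j) : K));
      let w : K := (x' (Fin.last n) : K);
      ((∃ h ∈ K₁, ∀ a ∈ K₁, O.valuation (w - h) ≤ O.valuation (w - a)) ∨ (∀ q : Polynomial K₁, q ≠ 0
      → ∃ a : K₁, O.valuation (Polynomial.aeval w q - algebraMap K₁ K (Polynomial.eval a q)) <
      O.valuation (Polynomial.aeval w q)))) := by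
  intro h
  have h1 := h 2 Nat.prime_two (ZMod 2) (RatFunc (ZMod 2)) (fg_top (ZMod 2))
    ((Polynomial.idealX (ZMod 2)).valuation (RatFunc (ZMod 2))).valuationSubring
    (const_mem_OX (ZMod 2)) (rankOne_OX (ZMod 2)) (zeroDim_OX (ZMod 2))
  obtain ⟨x', G, hx', -, hG, hax, -, -⟩ :=
    h1 0 (fun _ => ⟨RatFunc.X, X_mem_OX (ZMod 2)⟩) 0 (algInd_X (ZMod 2))
  have hG0 : G = 0 :=
    algebraicIndependent_iff_injective_aeval.mp hx' (by rw [hG, map_zero, map_zero])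
  subst hG0
  apply hax
  beta_reduce
  exact MvPolynomial.eval₂_zero _ _

/-- **Algebraic independence of the frame is load-bearing.** With `AlgebraicIndependent k x`
dropped the crux is FALSE: same place, `n = 0`, `x = (0)`, `g = X₀ ≠ 0`; again `G(x') = g(0) = 0`
forces `G = 0` and `axis 0 x' G = 0`. [folklore] -/
theorem pureTranscendentalFrames_false_without_algIndep :
    ¬ (
      ∀ p : ℕ, p.Prime → ∀ (k K : Type) [Field k] [CharP k p] [PerfectField k] [Field K] [Algebra k
      K], (⊤ : IntermediateField k K).FG → ∀ O : ValuationSubring K, ∀ hk : (∀ c : k, algebraMap k K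
      c ∈ O), Nonempty O.valuation.RankOne → (∀ x ∈ O, ∃ f : Polynomial k, f ≠ 0 ∧ Polynomial.aeval
      x f ∈ O.nonunits) →
      let ρ : k →+* IsLocalRing.ResidueField O := (IsLocalRing.residue O).comp ((algebraMap k
          K).codRestrict O hk);
      let axis : (m : ℕ) → (Fin (m + 1) → O) → MvPolynomial (Fin (m + 1)) k → Polynomial
          (IsLocalRing.ResidueField O) := fun _ w g => MvPolynomial.eval₂ (Polynomial.C.comp ρ)
          (Fin.snoc (fun j => Polynomial.C (IsLocalRing.residue O (w (Fin.castSucc j))))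
          Polynomial.X) g;
      ∀ (n : ℕ) (x : Fin (n + 1) → O) (g : MvPolynomial (Fin (n + 1)) k), g ≠ 0 → ∃ (x' : Fin (n +
      1) → O) (G : MvPolynomial (Fin (n + 1)) k), AlgebraicIndependent k (fun i => (x' i : K)) ∧ (∀
      i, (x i : K) ∈ Algebra.adjoin k (Set.range fun i => (x' i : K))) ∧ MvPolynomial.aeval (fun i
      => (x' i : K)) G = MvPolynomial.aeval (fun i => (x i : K)) g ∧ axis n x' G ≠ 0 ∧ (axis n x g ≠
      0 → (axis n x' G).rootMultiplicity (IsLocalRing.residue O (x' (Fin.last n))) ≤ (axis n x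
      g).rootMultiplicity (IsLocalRing.residue O (x (Fin.last n)))) ∧
      let K₁ : IntermediateField k K := IntermediateField.adjoin k (Set.range fun j : Fin n => (x'
          (Fin.castSucc j) : K));
      let w : K := (x' (Fin.last n) : K);
      ((∃ h ∈ K₁, ∀ a ∈ K₁, O.valuation (w - h) ≤ O.valuation (w - a)) ∨ (∀ q : Polynomial K₁, q ≠ 0
      → ∃ a : K₁, O.valuation (Polynomial.aeval w q - algebraMap K₁ K (Polynomial.eval a q)) <
      O.valuation (Polynomial.aeval w q)))) := by
  intro h
  have h1 := h 2 Nat.prime_two (ZMod 2) (RatFunc (ZMod 2)) (fg_top (ZMod 2))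
    ((Polynomial.idealX (ZMod 2)).valuation (RatFunc (ZMod 2))).valuationSubring
    (const_mem_OX (ZMod 2)) (rankOne_OX (ZMod 2)) (zeroDim_OX (ZMod 2))
  obtain ⟨x', G, hx', -, hG, hax, -, -⟩ :=
    h1 0
      (fun _ => (0 : ((Polynomial.idealX (ZMod 2)).valuation (RatFunc (ZMod 2))).valuationSubring))
      (MvPolynomial.X 0) (MvPolynomial.X_ne_zero _)
  have hG0 : G = 0 :=
    algebraicIndependent_iff_injective_aeval.mp hx'
      (by rw [hG, map_zero, MvPolynomial.aeval_X]; exact ZeroMemClass.coe_zero _)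
  subst hG0
  apply hax
  beta_reduce
  exact MvPolynomial.eval₂_zero _ _

/-- **The attained-distance disjunct is load-bearing** (the strengthening "transcendental type
only" is FALSE): same place, `n = 0`, `x = (X)`, `g = 1`. For ANY frame `x' = (w)`, `K₁ = k` and
`w ≡ c (mod 𝔪_O)` for a constant `c ∈ k` (the place is residually rational); for `q = X − c` and
every `a ∈ k`, `q(w) − q(a) = w − a` has value `v(w − c)` (`a = c`) or `1 > v(w − c)` (`a ≠ c`),
never `< v(q(w))`. [folklore] -/
theorem not_pureTranscendentalFrames_transcendentalTypeOnly :
    ¬ (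
      ∀ p : ℕ, p.Prime → ∀ (k K : Type) [Field k] [CharP k p] [PerfectField k] [Field K] [Algebra k
      K], (⊤ : IntermediateField k K).FG → ∀ O : ValuationSubring K, ∀ hk : (∀ c : k, algebraMap k K
      c ∈ O), Nonempty O.valuation.RankOne → (∀ x ∈ O, ∃ f : Polynomial k, f ≠ 0 ∧ Polynomial.aeval
      x f ∈ O.nonunits) →
      let ρ : k →+* IsLocalRing.ResidueField O := (IsLocalRing.residue O).comp ((algebraMap k
          K).codRestrict O hk);
      let axis : (m : ℕ) → (Fin (m + 1) → O) → MvPolynomial (Fin (m + 1)) k → Polynomial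
          (IsLocalRing.ResidueField O) := fun _ w g => MvPolynomial.eval₂ (Polynomial.C.comp ρ)
          (Fin.snoc (fun j => Polynomial.C (IsLocalRing.residue O (w (Fin.castSucc j))))
          Polynomial.X) g;
      ∀ (n : ℕ) (x : Fin (n + 1) → O) (g : MvPolynomial (Fin (n + 1)) k), AlgebraicIndependent k
      (fun i => (x i : K)) → g ≠ 0 → ∃ (x' : Fin (n + 1) → O) (G : MvPolynomial (Fin (n + 1)) k),
      AlgebraicIndependent k (fun i => (x' i : K)) ∧ (∀ i, (x i : K) ∈ Algebra.adjoin k (Set.range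
      fun i => (x' i : K))) ∧ MvPolynomial.aeval (fun i => (x' i : K)) G = MvPolynomial.aeval (fun i
      => (x i : K)) g ∧ axis n x' G ≠ 0 ∧ (axis n x g ≠ 0 → (axis n x' G).rootMultiplicity
      (IsLocalRing.residue O (x' (Fin.last n))) ≤ (axis n x g).rootMultiplicity (IsLocalRing.residue
      O (x (Fin.last n)))) ∧
      let K₁ : IntermediateField k K := IntermediateField.adjoin k (Set.range fun j : Fin n => (x'
          (Fin.castSucc j) : K));
      let w : K := (x' (Fin.last n) : K);
      (∀ q : Polynomial K₁, q ≠ 0 → ∃ a : K₁, O.valuation (Polynomial.aeval w q - algebraMap K₁ K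
      (Polynomial.eval a q)) < O.valuation (Polynomial.aeval w q))) := by
  intro h
  have h1 := h 2 Nat.prime_two (ZMod 2) (RatFunc (ZMod 2)) (fg_top (ZMod 2))
    ((Polynomial.idealX (ZMod 2)).valuation (RatFunc (ZMod 2))).valuationSubring
    (const_mem_OX (ZMod 2)) (rankOne_OX (ZMod 2)) (zeroDim_OX (ZMod 2))
  obtain ⟨x', G, hx', -, -, -, -, hpure⟩ :=
    h1 0 (fun _ => ⟨RatFunc.X, X_mem_OX (ZMod 2)⟩) 1 (algInd_X (ZMod 2)) one_ne_zero
  -- `w ≡ c₀ (mod 𝔪_O)` for a constant `c₀`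
  obtain ⟨c₀, hc₀⟩ :=
    exists_const_OX (ZMod 2) (x' (Fin.last 0) : RatFunc (ZMod 2)) (x' (Fin.last 0)).2
  -- test the strengthened purity with `q = X - c₀`
  obtain ⟨a, ha⟩ := hpure (Polynomial.X - Polynomial.C ⟨algebraMap (ZMod 2) (RatFunc (ZMod 2)) c₀,
    IntermediateField.algebraMap_mem _ c₀⟩) (Polynomial.X_sub_C_ne_zero _)
  simp only [map_sub, Polynomial.aeval_X, Polynomial.aeval_C, Polynomial.eval_sub,
    Polynomial.eval_X, Polynomial.eval_C, IntermediateField.algebraMap_apply,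
    sub_sub_sub_cancel_right] at ha
  rw [← (isEquiv_OX (ZMod 2)).lt_iff_lt] at ha
  -- `K₁ = k(∅) = ⊥`, so `a` is a constant `a₀`
  have hbot : IntermediateField.adjoin (ZMod 2)
      (Set.range fun j : Fin 0 => (x' (Fin.castSucc j) : RatFunc (ZMod 2))) = ⊥ := by
    rw [Set.range_eq_empty, IntermediateField.adjoin_empty]
  obtain ⟨a₀, ha₀⟩ := IntermediateField.mem_bot.mp (hbot.le a.2)
  rw [← ha₀] at ha
  by_cases h0 : a₀ = c₀
  · subst h0
    exact lt_irrefl _ ha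
  · have hca : (c₀ - a₀ : ZMod 2) ≠ 0 := sub_ne_zero.mpr (Ne.symm h0)
    have h1 : (Polynomial.idealX (ZMod 2)).valuation (RatFunc (ZMod 2))
        ((x' (Fin.last 0) : RatFunc (ZMod 2)) - algebraMap (ZMod 2) (RatFunc (ZMod 2)) a₀) = 1 := by
      have : (x' (Fin.last 0) : RatFunc (ZMod 2)) - algebraMap (ZMod 2) (RatFunc (ZMod 2)) a₀ =
          ((x' (Fin.last 0) : RatFunc (ZMod 2)) - algebraMap (ZMod 2) (RatFunc (ZMod 2)) c₀) +
            algebraMap (ZMod 2) (RatFunc (ZMod 2)) (c₀ - a₀) := by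
        rw [map_sub]; ring
      have hlt : (Polynomial.idealX (ZMod 2)).valuation (RatFunc (ZMod 2))
            ((x' (Fin.last 0) : RatFunc (ZMod 2)) - algebraMap (ZMod 2) (RatFunc (ZMod 2)) c₀) <
          (Polynomial.idealX (ZMod 2)).valuation (RatFunc (ZMod 2))
            (algebraMap (ZMod 2) (RatFunc (ZMod 2)) (c₀ - a₀)) := by
        rw [v_const_eq_one (ZMod 2) hca]; exact hc₀
      rw [this, Valuation.map_add_eq_of_lt_right _ hlt, v_const_eq_one (ZMod 2) hca]
    rw [h1] at ha
    exact lt_irrefl _ (ha.trans hc₀)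

end Refutations

end Summit.ResolutionOfSingularities.ResolutionOfSingularities.Theorems.PureTranscendentalFrames.Negative

end
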